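import Summits.Ventures.LatticeQCDFlow.Scoring.FreeFieldUnadjustedLeapfrog
import Mathlib.Probability.Distributions.Gaussian.Real
import HarnessLib

/-!
# The equilibrium energy violation of free-field leapfrog, exactly: `⟨ΔH⟩ = δ⁴Ω⁴ sin²(Nθ) / (32(1 − δ²Ω²/4))` per mode

HONEST FRAMING: exact (Metropolis-corrected) sampling algorithms for lattice gauge theory;
figures of merit are autocorrelation/cost numbers at stated couplings and volumes; no
continuum-physics claim.  (SCALAR calibration rung S0-A: not a gauge result.)

Venture `LatticeQCDFlow` (cell pub-lqcd), sub-topic `Scoring`; FANOUT row 2 (`s0-phi4`: the HMC arm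
of the 2D φ⁴ calibration — step-size tuning and cost accounting of the HMC comparator).  NEW WORK
of the cell over Mathlib; nothing is cited as a fact.  Printed counterparts, named only: Creutz
1988 (`⟨e^{−ΔH}⟩ = 1`, `⟨ΔH⟩ ≥ 0`), Gupta–Kilcup–Sharpe 1988 and Kennedy–Pendleton 1991 (the
`⟨ΔH⟩ ∝ Vδ⁴` law of leapfrog on free field theory and the `δ ∝ V^{−1/4}` step-size scaling at
fixed acceptance; `P_acc ≈ erfc(½√⟨ΔH⟩)`).

`Scoring/FreeFieldLeapfrog.lean` (row 2) proved the closed form of the energy violation along a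
trajectory, `ΔH_N = (δ²Ω²/8)(P_N² − P_0²)` per mode, and the rotation form of the trajectory;
`Scoring/FreeFieldUnadjustedLeapfrog.lean` that `β² = 1/Ω² − δ²/4`.  Here the violation is
AVERAGED OVER THE EXACT LAW `e^{−H}/Z = N(0, 1/Ω²) ⊗ N(0, 1)` of the mode — the equilibrium value
the Metropolis test of the exact chain sees:

## What is proved (one mode `Ω² = w2`, stable regime `δ²Ω² < 4`, `θ = arccos(1 − δ²Ω²/2)`)

* §1 `energyViolation_rotation` — pointwise, `ΔH_N(O, P) = (δ²Ω²/8)·[(−(sin Nθ/β) O + cos(Nθ) P)² − P²]`.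
* §2 **`leapfrog_mean_energy_violation_of_moments`** — for ANY law `ν` on `ℝ × ℝ` with the second
  moments of the exact one (`∫O² = 1/Ω²`, `∫OP = 0`, `∫P² = 1`, all integrable):
  `∫ ΔH_N dν = δ⁴Ω⁴ sin²(Nθ) / (32 (1 − δ²Ω²/4))` (linearity + `β² = (1 − δ²Ω²/4)/Ω²`).
* §3 `modeGibbsLaw Ω² = gaussianReal 0 (1/Ω²) ⊗ gaussianReal 0 1` (Mathlib's Gaussian; a
  probability measure), `integral_sq_gaussianReal` (`∫ x² dN(0,v) = v`),
  `integral_fst_sq_modeGibbsLaw`, `integral_fst_mul_snd_modeGibbsLaw`, `integral_snd_sq_modeGibbsLaw`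
  — the exact law has those moments; hence the headline **`leapfrog_mean_energy_violation`** —
  `∫ ΔH_N d(N(0,1/Ω²) ⊗ N(0,1)) = δ⁴Ω⁴ sin²(Nθ) / (32 (1 − δ²Ω²/4))`, for every `δ > 0`, `N`, in
  the stable regime — `O(δ⁴)` per mode with the EXACT prefactor, nonnegative
  (`meanEnergyViolation_nonneg`, Creutz's inequality with its value), vanishing exactly at the
  resonances `sin(Nθ) = 0`, at most `δ⁴Ω⁴/(32(1 − δ²Ω²/4))` (`meanEnergyViolation_le`) and
  increasing in `Ω²` (`meanEnergyViolationSup_mono`: the UV modes dominate).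
* Reading (not a theorem here): the lattice `ΔH` is the SUM over the `V` modes
  (`leapfrog_iterate_mode`), so `⟨ΔH⟩ ≤ V δ⁴Ω_max⁴/(32(1 − δ²Ω_max²/4))`, `Ω_max² = 2(4d + m²)`:
  fixed `⟨ΔH⟩` (fixed acceptance, `P_acc ≈ erfc(½√⟨ΔH⟩)`) forces `δ ∝ V^{−1/4}` — the cost law
  behind the HMC column of the cost accounting.  NOT CLAIMED: the acceptance formula itself,
  `Var(ΔH) = 2⟨ΔH⟩ + O(δ⁶)`, anything at `λ > 0`.
-/

namespace Summit.Ventures.LatticeQCDFlow.Scoring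

open Real MeasureTheory ProbabilityTheory Filter

/-! ## §1 The energy violation in rotation form -/

section Rotation

variable {δ w2 : ℝ}

/-- **`ΔH_N` as a quadratic form in the initial point**:
`ΔH_N(O, P) = (δ²Ω²/8)·[(−(sin Nθ/β) O + cos(Nθ) P)² − P²]`. -/
theorem energyViolation_rotation (hδ : 0 < δ) (hw : 0 < w2) (hst : δ ^ 2 * w2 < 4) (z : ℝ × ℝ)
    (N : ℕ) :
    (w2 * ((lfMode δ w2)^[N] z).1 ^ 2 + ((lfMode δ w2)^[N] z).2 ^ 2) / 2 - (w2 * z.1 ^ 2 + z.2 ^ 2) / 2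
      = δ ^ 2 * w2 / 8 * ((-(Real.sin (N * Real.arccos (1 - δ ^ 2 * w2 / 2))
          / (δ * (1 - δ ^ 2 * w2 / 4) / Real.sin (Real.arccos (1 - δ ^ 2 * w2 / 2)))) * z.1
          + Real.cos (N * Real.arccos (1 - δ ^ 2 * w2 / 2)) * z.2) ^ 2 - z.2 ^ 2) := by
  rw [lfMode_iterate_energy_violation δ w2 z N, lfMode_iterate_rotation δ w2 hδ hw hst z N]

end Rotation

/-! ## §2 The mean violation from the second moments -/

section Moments

variable {δ w2 : ℝ}

/-- **Mean energy violation from the equilibrium second moments.**  For ANY measure `ν` on the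
mode's phase space whose second moments are those of the exact law (`∫O² = 1/Ω²`, `∫OP = 0`,
`∫P² = 1`): `∫ ΔH_N dν = δ⁴Ω⁴ sin²(Nθ) / (32 (1 − δ²Ω²/4))`. -/
theorem leapfrog_mean_energy_violation_of_moments (hδ : 0 < δ) (hw : 0 < w2)
    (hst : δ ^ 2 * w2 < 4) (N : ℕ) (ν : Measure (ℝ × ℝ))
    (hO2 : Integrable (fun z : ℝ × ℝ => z.1 ^ 2) ν) (hOP : Integrable (fun z : ℝ × ℝ => z.1 * z.2) ν)
    (hP2 : Integrable (fun z : ℝ × ℝ => z.2 ^ 2) ν) (hA : ∫ z, z.1 ^ 2 ∂ν = 1 / w2)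
    (hB : ∫ z, z.1 * z.2 ∂ν = 0) (hC : ∫ z, z.2 ^ 2 ∂ν = 1) :
    ∫ z, ((w2 * ((lfMode δ w2)^[N] z).1 ^ 2 + ((lfMode δ w2)^[N] z).2 ^ 2) / 2
        - (w2 * z.1 ^ 2 + z.2 ^ 2) / 2) ∂ν
      = δ ^ 4 * w2 ^ 2 * Real.sin (N * Real.arccos (1 - δ ^ 2 * w2 / 2)) ^ 2
          / (32 * (1 - δ ^ 2 * w2 / 4)) := by
  set s := Real.sin (N * Real.arccos (1 - δ ^ 2 * w2 / 2)) with hs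
  set c := Real.cos (N * Real.arccos (1 - δ ^ 2 * w2 / 2)) with hc
  set β := δ * (1 - δ ^ 2 * w2 / 4) / Real.sin (Real.arccos (1 - δ ^ 2 * w2 / 2)) with hβ
  have hq : 0 < 1 - δ ^ 2 * w2 / 4 := by nlinarith
  have hβ2 : β ^ 2 = (1 - δ ^ 2 * w2 / 4) / w2 := by
    rw [hβ, rotation_beta_sq hδ.ne' hw hst, shadowVariance_eq hw.ne']
  have hβ0 : β ≠ 0 := by
    intro h0
    rw [h0] at hβ2
    have : (0 : ℝ) < (1 - δ ^ 2 * w2 / 4) / w2 := div_pos hq hw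
    nlinarith
  have hsc : s ^ 2 + c ^ 2 = 1 := Real.sin_sq_add_cos_sq _
  -- pointwise: a quadratic form in `(O, P)`
  have hpt : ∀ z : ℝ × ℝ,
      (w2 * ((lfMode δ w2)^[N] z).1 ^ 2 + ((lfMode δ w2)^[N] z).2 ^ 2) / 2
          - (w2 * z.1 ^ 2 + z.2 ^ 2) / 2
        = δ ^ 2 * w2 / 8 * (s / β) ^ 2 * z.1 ^ 2
          - δ ^ 2 * w2 / 8 * (2 * (s / β) * c) * (z.1 * z.2)
          + δ ^ 2 * w2 / 8 * (c ^ 2 - 1) * z.2 ^ 2 := by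
    intro z
    rw [energyViolation_rotation hδ hw hst z N]
    ring
  simp_rw [hpt]
  have i1 : Integrable (fun z : ℝ × ℝ => δ ^ 2 * w2 / 8 * (s / β) ^ 2 * z.1 ^ 2) ν :=
    hO2.const_mul _
  have i2 : Integrable (fun z : ℝ × ℝ => δ ^ 2 * w2 / 8 * (2 * (s / β) * c) * (z.1 * z.2)) ν :=
    hOP.const_mul _
  have i3 : Integrable (fun z : ℝ × ℝ => δ ^ 2 * w2 / 8 * (c ^ 2 - 1) * z.2 ^ 2) ν :=
    hP2.const_mul _
  have i12 : Integrable (fun z : ℝ × ℝ => δ ^ 2 * w2 / 8 * (s / β) ^ 2 * z.1 ^ 2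
      - δ ^ 2 * w2 / 8 * (2 * (s / β) * c) * (z.1 * z.2)) ν := i1.sub i2
  rw [integral_add i12 i3, integral_sub i1 i2, integral_const_mul, integral_const_mul,
    integral_const_mul, hA, hB, hC, div_pow, hβ2]
  have hc2 : c ^ 2 - 1 = -s ^ 2 := by linarith
  have hq4 : 4 - δ ^ 2 * w2 ≠ 0 := by linarith
  have hw0 : w2 ≠ 0 := hw.ne'
  rw [hc2]
  field_simp
  ring

end Moments

/-! ## §3 The exact law has those moments: the headline -/

section Gaussian

/-- The exact law of one free mode: `N(0, 1/Ω²) ⊗ N(0, 1)` = `e^{−½(Ω²O² + P²)} dO dP / Z`. -/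
noncomputable def modeGibbsLaw (w2 : ℝ) : Measure (ℝ × ℝ) :=
  (gaussianReal 0 (1 / w2).toNNReal).prod (gaussianReal 0 1)

/-- The exact law of one mode is a probability measure. -/
instance instIsProbabilityMeasureModeGibbsLaw (w2 : ℝ) : IsProbabilityMeasure (modeGibbsLaw w2) := by
  unfold modeGibbsLaw; infer_instance

/-- Second moment of a centred Gaussian: `∫ x² dN(0, v) = v`. -/
theorem integral_sq_gaussianReal (v : NNReal) : ∫ x, x ^ 2 ∂gaussianReal 0 v = v := by
  have hvar := variance_fun_id_gaussianReal (μ := 0) (v := v)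
  rw [variance_of_integral_eq_zero (by fun_prop) integral_id_gaussianReal] at hvar
  exact hvar

/-- `x²` is integrable under a Gaussian. -/
theorem integrable_sq_gaussianReal (μ : ℝ) (v : NNReal) :
    Integrable (fun x : ℝ => x ^ 2) (gaussianReal μ v) :=
  (memLp_id_gaussianReal 2).integrable_sq

/-- `x` is integrable under a Gaussian. -/
theorem integrable_id_gaussianReal (μ : ℝ) (v : NNReal) :
    Integrable (fun x : ℝ => x) (gaussianReal μ v) :=
  (memLp_id_gaussianReal 1).integrable le_rfl

variable {w2 : ℝ}

/-- `∫ O² = 1/Ω²` under the exact law. -/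
theorem integral_fst_sq_modeGibbsLaw (hw : 0 < w2) :
    ∫ z, z.1 ^ 2 ∂modeGibbsLaw w2 = 1 / w2 := by
  unfold modeGibbsLaw
  have h := integral_prod_mul (μ := gaussianReal 0 (1 / w2).toNNReal) (ν := gaussianReal 0 1)
    (fun x : ℝ => x ^ 2) (fun _ : ℝ => (1 : ℝ))
  simp only [mul_one, integral_const, probReal_univ, smul_eq_mul] at h
  rw [h, integral_sq_gaussianReal, Real.coe_toNNReal _ (by positivity)]

/-- `∫ O·P = 0` under the exact law. -/
theorem integral_fst_mul_snd_modeGibbsLaw (w2 : ℝ) :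
    ∫ z, z.1 * z.2 ∂modeGibbsLaw w2 = 0 := by
  unfold modeGibbsLaw
  rw [integral_prod_mul (fun x : ℝ => x) (fun y : ℝ => y), integral_id_gaussianReal,
    integral_id_gaussianReal, mul_zero]

/-- `∫ P² = 1` under the exact law. -/
theorem integral_snd_sq_modeGibbsLaw (w2 : ℝ) :
    ∫ z, z.2 ^ 2 ∂modeGibbsLaw w2 = 1 := by
  unfold modeGibbsLaw
  have h := integral_prod_mul (μ := gaussianReal 0 (1 / w2).toNNReal) (ν := gaussianReal 0 1)
    (fun _ : ℝ => (1 : ℝ)) (fun y : ℝ => y ^ 2)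
  simp only [one_mul, integral_const, probReal_univ, smul_eq_mul] at h
  rw [h, integral_sq_gaussianReal]
  simp

/-- The three quadratic observables are integrable under the exact law. -/
theorem integrable_moments_modeGibbsLaw (w2 : ℝ) :
    Integrable (fun z : ℝ × ℝ => z.1 ^ 2) (modeGibbsLaw w2)
      ∧ Integrable (fun z : ℝ × ℝ => z.1 * z.2) (modeGibbsLaw w2)
      ∧ Integrable (fun z : ℝ × ℝ => z.2 ^ 2) (modeGibbsLaw w2) := by
  unfold modeGibbsLaw
  refine ⟨?_, ?_, ?_⟩
  · have h := (integrable_sq_gaussianReal 0 (1 / w2).toNNReal).mul_prod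
      (integrable_const (1 : ℝ) (μ := gaussianReal 0 1))
    simpa using h
  · exact (integrable_id_gaussianReal 0 _).mul_prod (integrable_id_gaussianReal 0 1)
  · have h := (integrable_const (1 : ℝ) (μ := gaussianReal 0 (1 / w2).toNNReal)).mul_prod
      (integrable_sq_gaussianReal 0 1)
    simpa using h

/-- **THE EQUILIBRIUM ENERGY VIOLATION OF FREE-FIELD LEAPFROG, EXACTLY.**  Averaged over the exact
law `N(0, 1/Ω²) ⊗ N(0, 1)` of the mode, after `N` leapfrog steps of size `δ` (stable regime):
`⟨ΔH_N⟩ = δ⁴Ω⁴ sin²(Nθ) / (32 (1 − δ²Ω²/4))`, `θ = arccos(1 − δ²Ω²/2)`. -/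
theorem leapfrog_mean_energy_violation {δ : ℝ} (hδ : 0 < δ) (hw : 0 < w2) (hst : δ ^ 2 * w2 < 4)
    (N : ℕ) :
    ∫ z, ((w2 * ((lfMode δ w2)^[N] z).1 ^ 2 + ((lfMode δ w2)^[N] z).2 ^ 2) / 2
        - (w2 * z.1 ^ 2 + z.2 ^ 2) / 2) ∂modeGibbsLaw w2
      = δ ^ 4 * w2 ^ 2 * Real.sin (N * Real.arccos (1 - δ ^ 2 * w2 / 2)) ^ 2
          / (32 * (1 - δ ^ 2 * w2 / 4)) := by
  obtain ⟨h1, h2, h3⟩ := integrable_moments_modeGibbsLaw w2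
  exact leapfrog_mean_energy_violation_of_moments hδ hw hst N _ h1 h2 h3
    (integral_fst_sq_modeGibbsLaw hw) (integral_fst_mul_snd_modeGibbsLaw w2)
    (integral_snd_sq_modeGibbsLaw w2)

/-! ### Consequences for the value -/

/-- The mean violation of one mode, as a function of `(δ, Ω², N)`. -/
noncomputable def meanEnergyViolation (δ w2 : ℝ) (N : ℕ) : ℝ :=
  δ ^ 4 * w2 ^ 2 * Real.sin (N * Real.arccos (1 - δ ^ 2 * w2 / 2)) ^ 2 / (32 * (1 - δ ^ 2 * w2 / 4))

/-- **Creutz's inequality with its value**: `⟨ΔH_N⟩ ≥ 0` (stable regime). -/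
theorem meanEnergyViolation_nonneg {δ : ℝ} (hst : δ ^ 2 * w2 < 4) (N : ℕ) :
    0 ≤ meanEnergyViolation δ w2 N := by
  unfold meanEnergyViolation
  have hq : 0 < 1 - δ ^ 2 * w2 / 4 := by linarith
  positivity

/-- At a RESONANCE `sin(Nθ) = 0` the violation vanishes identically in the mean. -/
theorem meanEnergyViolation_eq_zero_of_resonance {δ : ℝ} {N : ℕ}
    (hres : Real.sin (N * Real.arccos (1 - δ ^ 2 * w2 / 2)) = 0) :
    meanEnergyViolation δ w2 N = 0 := by
  unfold meanEnergyViolation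
  rw [hres]
  simp

/-- **Uniform bound in the trajectory length**: `⟨ΔH_N⟩ ≤ δ⁴Ω⁴ / (32 (1 − δ²Ω²/4))`. -/
theorem meanEnergyViolation_le {δ : ℝ} (hst : δ ^ 2 * w2 < 4) (N : ℕ) :
    meanEnergyViolation δ w2 N ≤ δ ^ 4 * w2 ^ 2 / (32 * (1 - δ ^ 2 * w2 / 4)) := by
  unfold meanEnergyViolation
  have hq : 0 < 32 * (1 - δ ^ 2 * w2 / 4) := by linarith
  have hs : Real.sin (N * Real.arccos (1 - δ ^ 2 * w2 / 2)) ^ 2 ≤ 1 := Real.sin_sq_le_one _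
  have hnum : 0 ≤ δ ^ 4 * w2 ^ 2 := by positivity
  rw [div_le_div_iff_of_pos_right hq]
  nlinarith

/-- **The UV modes dominate**: the bound `δ⁴Ω⁴ / (32 (1 − δ²Ω²/4))` is increasing in `Ω²` on the
stable range — summed over the `V` modes of the lattice it is at most `V` times its value at
`Ω_max² = 2(4d + m²)`, whence `δ ∝ V^{−1/4}` at fixed `⟨ΔH⟩`. -/
theorem meanEnergyViolationSup_mono {δ a b : ℝ} (ha : 0 ≤ a) (hab : a ≤ b) (hb : δ ^ 2 * b < 4) :
    δ ^ 4 * a ^ 2 / (32 * (1 - δ ^ 2 * a / 4)) ≤ δ ^ 4 * b ^ 2 / (32 * (1 - δ ^ 2 * b / 4)) := by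
  have hδ2 : 0 ≤ δ ^ 2 := sq_nonneg δ
  have hqa : 0 < 32 * (1 - δ ^ 2 * a / 4) := by nlinarith
  have hqb : 0 < 32 * (1 - δ ^ 2 * b / 4) := by linarith
  have hnum : δ ^ 4 * a ^ 2 ≤ δ ^ 4 * b ^ 2 := by
    have : a ^ 2 ≤ b ^ 2 := pow_le_pow_left₀ ha hab 2
    have hδ4 : 0 ≤ δ ^ 4 := by positivity
    exact mul_le_mul_of_nonneg_left this hδ4
  have hden : 32 * (1 - δ ^ 2 * b / 4) ≤ 32 * (1 - δ ^ 2 * a / 4) := by nlinarith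
  exact div_le_div₀ (by positivity) hnum hqb hden

end Gaussian

end Summit.Ventures.LatticeQCDFlow.Scoring
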